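import Literature.Barriers.CriticalPhenomena.WeaklySAWFourDimLogCorrectionsCesaroProofs
import Literature.Analysis.Asymptotics.KaramataAbelianLaplace
import HarnessLib

/-!
# BBS 2015, §1.3: the Cesàro statement is EQUIVALENT to the susceptibility asymptotics (1.9)

Companion (theorems only) to `WeaklySAWFourDimLogCorrectionsCesaro.lean` (the named fact
`CTWSAW.BBS2015_cesaro_corrected`, the sign-corrected first display of §1.3 of R. Bauerschmidt,
D. C. Brydges, G. Slade, *Logarithmic correction for the susceptibility of the 4-dimensional weakly
self-avoiding walk: a renormalisation group analysis*, CMP 337 (2015), arXiv:1403.7422) and to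
`WeaklySAWFourDimLogCorrectionsCesaroProofs.lean`, which derives it from Theorem 1.1
(`CTWSAW.BBS2015_thm11`) by Karamata's TAUBERIAN theorem, as the paper says ("Theorem 1.1 and a
standard Tauberian theorem [Fell71] imply …").

Feller's Theorem XIII.5.2 is an equivalence, and its ABELIAN half
(`Literature.Analysis.Asymptotics.karamata_abelian_laplace`, `KaramataAbelianLaplace.lean`) gives
the converse here: by (1.3), `χ(g, ν_c + ε) = ∫₀^∞ (c_T e^{-ν_c T}) e^{-εT} dT` is the Laplace
transform of the non-negative density `u(T) = c_T e^{-ν_c T}` whose primitive is the Cesàro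
numerator `∫₀ᵀ c_S e^{-ν_c S} dS`, so `T⁻¹∫₀ᵀ c_S e^{-ν_c S} dS ∼ A (log T)^{1/4}` (`T → ∞`) implies
`χ(g, ν_c + ε) ∼ A ε⁻¹ (log ε⁻¹)^{1/4}` (`ε ↓ 0`) with the SAME constant `A`. Consequently:

* `CTWSAW.tendsto_susceptibility_iff_tendsto_cesaro` — for each `g ≥ 0` and `A > 0`, display (1.9)
  of Theorem 1.1 with constant `A` holds iff the (corrected) Cesàro display of §1.3 holds with
  constant `A`;
* `CTWSAW.BBS2015_cesaro_corrected_iff` — the named fact `BBS2015_cesaro_corrected` is equivalent to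
  the (1.9)-clause of Theorem 1.1 ("for all sufficiently small `g > 0` there is `A_g > 0` with
  `χ(g, ν_c + ε) ∼ A_g ε⁻¹(log ε⁻¹)^{1/4}`"), i.e. to Theorem 1.1 minus its amplitude clause (1.10)
  `A_g = (𝖻g)^{1/4}(1 + O(g))`;
* `CTWSAW.BBS2015_thm11_iff_cesaro` — Theorem 1.1 itself (both displays) is equivalent to its
  Cesàro form with the amplitude clause carried along; the same for the catalogued barrier
  `WeaklySAWFourDimLogCorrections` (`CTWSAW.weaklySAWFourDimLogCorrections_iff_cesaro`).

So the Cesàro corollary is exactly as strong as the main clause of Theorem 1.1: there is no route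
to `BBS2015_cesaro_corrected` that avoids the logarithmic susceptibility asymptotics (the output of
the renormalisation-group Theorem 4.1, `CTWSAW.BBS2015_thm41`, to which the tree reduces
Theorem 1.1), and conversely a proof of the Cesàro statement by any other means would give (1.9).
Nothing new is asserted; `BBS2015_cesaro_corrected` stays a named fact pending `BBS2015_thm41`.

## References

* Bauerschmidt–Brydges–Slade 2015, §1.1 (1.3), Theorem 1.1 (1.9)–(1.10), §1.3 (first display).
  [cite: BauerschmidtBrydgesSlade2015LogCorr]
* W. Feller, *An Introduction to Probability Theory and Its Applications* II, 2nd ed. 1971,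
  XIII.5 Theorem 2 (both directions). [cite: Feller1971]
-/

noncomputable section

open MeasureTheory Filter Topology Set
open scoped ENNReal

namespace Literature.Barriers.CriticalPhenomena

namespace CTWSAW

open Literature.Analysis.Asymptotics Literature.Probability.LatticeModels

/-! ### The Abelian step: Cesàro asymptotics of `c_T e^{-ν_c T}` ⟹ (1.9) -/

/-- **The Abelian step of BBS 2015, §1.3, for one value of `g`** (converse of
`tendsto_cesaro_of_tendsto_susceptibility`): if `g ≥ 0`, `A > 0` and
`∫₀ᵀ c_S e^{-ν_c S} dS / (T · A (log T)^{1/4}) → 1` as `T → ∞`, then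
`χ(g, ν_c + ε) / (A ε⁻¹ (log ε⁻¹)^{1/4}) → 1` as `ε ↓ 0` — display (1.9) of Theorem 1.1 with the same
constant. Proof: the Abelian half of Feller's Theorem XIII.5.2 (`ρ = 1`,
`Literature.Analysis.Asymptotics.karamata_abelian_laplace`) applied to the density
`u(t) = c_t e^{-ν_c t} ∈ [0, e^{|ν_c| t}]` (measurable, locally integrable), whose Laplace transform
at `ε > 0` is `χ(g, ν_c + ε) < ∞` by (1.3) and Lemma A.1, with the slowly varying factor
`L = (log ·)^{1/4}`.
[cite: BauerschmidtBrydgesSlade2015LogCorr, §1.3 (Cesàro average of c_T) with (1.3) and Theorem 1.1 (1.9)]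
[cite: Feller1971, XIII.5 Theorem 2 (ρ = 1, Abelian direction)] -/
theorem tendsto_susceptibility_of_tendsto_cesaro {g A : ℝ} (hg : 0 ≤ g) (hA : 0 < A)
    (h : Tendsto (fun T : ℝ =>
        (∫⁻ S in Set.Ioc 0 T,
            survival 4 g S * ENNReal.ofReal (Real.exp (-criticalNu 4 g * S))).toReal /
          (T * (A * Real.log T ^ (1 / 4 : ℝ))))
      atTop (𝓝 1)) :
    Tendsto (fun ε : ℝ =>
        (susceptibility 4 g (criticalNu 4 g + ε)).toReal / (A * ε⁻¹ * Real.log ε⁻¹ ^ (1 / 4 : ℝ)))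
      (𝓝[>] 0) (𝓝 1) := by
  set νc := criticalNu 4 g with hνc
  set u : ℝ → ℝ := fun t => (survival 4 g t).toReal * Real.exp (-(νc * t)) with hu
  set L : ℝ → ℝ := fun x => Real.log x ^ (1 / 4 : ℝ) with hL
  -- the hypotheses of the Abelian theorem
  have hu0 : ∀ t, 0 < t → 0 ≤ u t := fun t _ =>
    mul_nonneg ENNReal.toReal_nonneg (Real.exp_pos _).le
  have humeas : Measurable u :=
    (measurable_survival 4 g).ennreal_toReal.mul ((measurable_const.mul measurable_id).neg.exp)
  have huint : ∀ T : ℝ, IntegrableOn u (Set.Ioc 0 T) := by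
    intro T
    refine Measure.integrableOn_of_bounded measure_Ioc_lt_top.ne humeas.aestronglyMeasurable
      (M := Real.exp (|νc| * |T|)) ?_
    rw [ae_restrict_iff' measurableSet_Ioc]
    refine ae_of_all _ fun t ht => ?_
    have hc : (survival 4 g t).toReal ≤ 1 := by
      have := ENNReal.toReal_mono ENNReal.one_ne_top (survival_le_one hg 4 ht.1)
      simpa using this
    rw [Real.norm_eq_abs, hu]
    simp only
    rw [abs_mul, abs_of_nonneg ENNReal.toReal_nonneg, Real.abs_exp]
    calc (survival 4 g t).toReal * Real.exp (-(νc * t)) ≤ 1 * Real.exp (|νc| * |T|) := by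
          refine mul_le_mul hc (Real.exp_le_exp.mpr ?_) (Real.exp_pos _).le zero_le_one
          calc -(νc * t) ≤ |-(νc * t)| := le_abs_self _
            _ = |νc| * |t| := by rw [abs_neg, abs_mul]
            _ ≤ |νc| * |T| := by
                refine mul_le_mul_of_nonneg_left ?_ (abs_nonneg _)
                rw [abs_of_pos ht.1]
                exact ht.2.trans (le_abs_self T)
      _ = Real.exp (|νc| * |T|) := one_mul _
  have hLsv : IsSlowlyVarying L := isSlowlyVarying_log_rpow _
  have hLpos : ∀ᶠ x in atTop, 0 < L x := by
    filter_upwards [eventually_gt_atTop 1] with x hx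
    exact Real.rpow_pos_of_pos (Real.log_pos hx) _
  -- the Cesàro numerator is the primitive of `u`
  have hconv : ∀ T : ℝ, ∫ t in Set.Ioc 0 T, u t =
      (∫⁻ S in Set.Ioc 0 T, survival 4 g S * ENNReal.ofReal (Real.exp (-νc * S))).toReal := by
    intro T
    have hmeas : AEMeasurable (fun S => survival 4 g S * ENNReal.ofReal (Real.exp (-νc * S)))
        (volume.restrict (Set.Ioc 0 T)) :=
      ((measurable_survival 4 g).mul
        ((measurable_const.mul measurable_id).exp.ennreal_ofReal)).aemeasurable
    have hae : ∀ᵐ S ∂(volume.restrict (Set.Ioc 0 T)),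
        survival 4 g S * ENNReal.ofReal (Real.exp (-νc * S)) < ∞ := by
      rw [ae_restrict_iff' measurableSet_Ioc]
      refine ae_of_all _ fun S hS => ENNReal.mul_lt_top ?_ ENNReal.ofReal_lt_top
      exact (survival_le_one hg 4 hS.1).trans_lt ENNReal.one_lt_top
    rw [← integral_toReal hmeas hae]
    refine integral_congr_ae (ae_of_all _ fun t => ?_)
    simp only [hu, ENNReal.toReal_mul, ENNReal.toReal_ofReal (Real.exp_pos _).le, neg_mul]
  have hU : Tendsto (fun T : ℝ => (∫ t in Set.Ioc 0 T, u t) / (T * L T)) atTop (𝓝 A) := by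
    have h2 := h.const_mul A
    rw [mul_one] at h2
    refine h2.congr' ?_
    filter_upwards [eventually_gt_atTop 1] with T hT
    rw [hconv T]
    have hLT : L T ≠ 0 := (Real.rpow_pos_of_pos (Real.log_pos hT) _).ne'
    simp only [hL] at hLT ⊢
    field_simp
  -- the Abelian theorem
  obtain ⟨-, hω⟩ := karamata_abelian_laplace hA hu0 humeas huint hLsv hLpos hU
  -- the Laplace transform of `u` at `δ` is `χ(g, ν_c + δ)`, by (1.3)
  have hfin : ∀ δ : ℝ, 0 < δ → susceptibility 4 g (νc + δ) < ∞ := fun δ hδ =>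
    susceptibility_lt_top_of_criticalNu_lt hg (by rw [hνc]; linarith)
  have hlap : ∀ δ : ℝ, 0 < δ → ∫ t in Set.Ioi (0 : ℝ), u t * Real.exp (-(δ * t)) =
      (susceptibility 4 g (νc + δ)).toReal := by
    intro δ hδ
    rw [← (integral_survival_toReal (hfin δ hδ)).2]
    refine integral_congr_ae (ae_of_all _ fun t => ?_)
    simp only [hu]
    rw [← hνc, add_sub_cancel_left]
  -- back to the ratio form of (1.9)
  have h3 := hω.div_const A
  rw [div_self hA.ne'] at h3
  refine h3.congr' ?_
  filter_upwards [Ioo_mem_nhdsGT one_pos] with δ hδ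
  rw [hlap δ hδ.1]
  have hδ0 : δ ≠ 0 := hδ.1.ne'
  have hlog : 0 < Real.log δ⁻¹ := Real.log_pos (one_lt_inv₀ hδ.1 |>.mpr hδ.2)
  have hL0 : L δ⁻¹ ≠ 0 := (Real.rpow_pos_of_pos hlog _).ne'
  simp only [hL] at hL0 ⊢
  field_simp

/-- **(1.9) with constant `A` ⟺ the corrected Cesàro display with constant `A`**, for each
`g ≥ 0` and `A > 0`: Feller's Theorem XIII.5.2 (`ρ = 1`) in both directions, applied to the
density `c_T e^{-ν_c T}` whose Laplace transform is `χ(g, ν_c + ·)` by (1.3)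
(`tendsto_cesaro_of_tendsto_susceptibility`, `tendsto_susceptibility_of_tendsto_cesaro`).
[cite: BauerschmidtBrydgesSlade2015LogCorr, §1.3 (Cesàro average of c_T) with Theorem 1.1 (1.9)]
[cite: Feller1971, XIII.5 Theorem 2 (ρ = 1)] -/
theorem tendsto_susceptibility_iff_tendsto_cesaro {g A : ℝ} (hg : 0 ≤ g) (hA : 0 < A) :
    Tendsto (fun ε : ℝ =>
        (susceptibility 4 g (criticalNu 4 g + ε)).toReal / (A * ε⁻¹ * Real.log ε⁻¹ ^ (1 / 4 : ℝ)))
      (𝓝[>] 0) (𝓝 1) ↔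
    Tendsto (fun T : ℝ =>
        (∫⁻ S in Set.Ioc 0 T,
            survival 4 g S * ENNReal.ofReal (Real.exp (-criticalNu 4 g * S))).toReal /
          (T * (A * Real.log T ^ (1 / 4 : ℝ))))
      atTop (𝓝 1) :=
  ⟨tendsto_cesaro_of_tendsto_susceptibility hA, tendsto_susceptibility_of_tendsto_cesaro hg hA⟩

/-! ### The named fact and Theorem 1.1 in Cesàro form -/

/-- **`BBS2015_cesaro_corrected` ⟺ the (1.9)-clause of Theorem 1.1**: the sign-corrected Cesàro
statement of §1.3 holds iff for all sufficiently small `g > 0` there is `A > 0` with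
`χ(g, ν_c + ε)/(A ε⁻¹(log ε⁻¹)^{1/4}) → 1` as `ε ↓ 0` (Theorem 1.1 without its amplitude clause
(1.10)); the constants `A` correspond. [cite: BauerschmidtBrydgesSlade2015LogCorr, §1.3 (Cesàro average of c_T) and Theorem 1.1 (1.9)] -/
theorem BBS2015_cesaro_corrected_iff :
    BBS2015_cesaro_corrected ↔
      ∃ g₀ : ℝ, 0 < g₀ ∧ ∀ g : ℝ, 0 < g → g < g₀ →
        ∃ A : ℝ, 0 < A ∧
          Tendsto (fun ε : ℝ =>
              (susceptibility 4 g (criticalNu 4 g + ε)).toReal /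
                (A * ε⁻¹ * Real.log ε⁻¹ ^ (1 / 4 : ℝ)))
            (𝓝[>] 0) (𝓝 1) := by
  constructor
  · rintro ⟨g₀, hg₀, hg⟩
    refine ⟨g₀, hg₀, fun g hg0 hgg => ?_⟩
    obtain ⟨A, hA, hT⟩ := hg g hg0 hgg
    exact ⟨A, hA, tendsto_susceptibility_of_tendsto_cesaro hg0.le hA hT⟩
  · rintro ⟨g₀, hg₀, hg⟩
    refine ⟨g₀, hg₀, fun g hg0 hgg => ?_⟩
    obtain ⟨A, hA, hT⟩ := hg g hg0 hgg
    exact ⟨A, hA, tendsto_cesaro_of_tendsto_susceptibility hA hT⟩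

/-- **Theorem 1.1 ⟺ its Cesàro form**: `BBS2015_thm11` (both displays (1.9)–(1.10)) holds iff there
are `g₀ > 0` and `K` such that for every `g ∈ (0, g₀)` some `A > 0` satisfies the amplitude clause
`|A/(𝖻g)^{1/4} - 1| ≤ Kg` AND the corrected Cesàro display
`∫₀ᵀ c_S e^{-ν_c S} dS/(T · A(log T)^{1/4}) → 1` — i.e. the sentence of §1.3 ("Theorem 1.1 and a
standard Tauberian theorem imply …") loses nothing: with Feller's theorem read in both directions
the Cesàro statement (with the amplitude law) is a reformulation of Theorem 1.1.
[cite: BauerschmidtBrydgesSlade2015LogCorr, Theorem 1.1 (1.9)–(1.10) and §1.3 (Cesàro average of c_T)]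
[cite: Feller1971, XIII.5 Theorem 2 (ρ = 1)] -/
theorem BBS2015_thm11_iff_cesaro :
    BBS2015_thm11 ↔
      ∃ g₀ K : ℝ, 0 < g₀ ∧ ∀ g : ℝ, 0 < g → g < g₀ →
        ∃ A : ℝ, 0 < A ∧ |A / (freeBubbleB * g) ^ (1 / 4 : ℝ) - 1| ≤ K * g ∧
          Tendsto (fun T : ℝ =>
              (∫⁻ S in Set.Ioc 0 T,
                  survival 4 g S * ENNReal.ofReal (Real.exp (-criticalNu 4 g * S))).toReal /
                (T * (A * Real.log T ^ (1 / 4 : ℝ))))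
            atTop (𝓝 1) := by
  constructor
  · rintro ⟨g₀, K, hg₀, hg⟩
    refine ⟨g₀, K, hg₀, fun g hg0 hgg => ?_⟩
    obtain ⟨A, hA, hamp, hT⟩ := hg g hg0 hgg
    exact ⟨A, hA, hamp, tendsto_cesaro_of_tendsto_susceptibility hA hT⟩
  · rintro ⟨g₀, K, hg₀, hg⟩
    refine ⟨g₀, K, hg₀, fun g hg0 hgg => ?_⟩
    obtain ⟨A, hA, hamp, hT⟩ := hg g hg0 hgg
    exact ⟨A, hA, hamp, tendsto_susceptibility_of_tendsto_cesaro hg0.le hA hT⟩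

/-- The same equivalence for the catalogued barrier statement `WeaklySAWFourDimLogCorrections`
(which is `BBS2015_thm11`). [cite: BauerschmidtBrydgesSlade2015LogCorr, Theorem 1.1 and §1.3] -/
theorem weaklySAWFourDimLogCorrections_iff_cesaro :
    WeaklySAWFourDimLogCorrections ↔
      ∃ g₀ K : ℝ, 0 < g₀ ∧ ∀ g : ℝ, 0 < g → g < g₀ →
        ∃ A : ℝ, 0 < A ∧ |A / (freeBubbleB * g) ^ (1 / 4 : ℝ) - 1| ≤ K * g ∧
          Tendsto (fun T : ℝ =>
              (∫⁻ S in Set.Ioc 0 T,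
                  survival 4 g S * ENNReal.ofReal (Real.exp (-criticalNu 4 g * S))).toReal /
                (T * (A * Real.log T ^ (1 / 4 : ℝ))))
            atTop (𝓝 1) :=
  weaklySAWFourDimLogCorrections_iff.trans BBS2015_thm11_iff_cesaro

/-- **The (1.9)-clause of Theorem 1.1 from the named fact**: `BBS2015_cesaro_corrected` gives, for
all sufficiently small `g > 0`, some `A > 0` with `χ(g, ν_c + ε) ∼ A ε⁻¹(log ε⁻¹)^{1/4}`
(the forward direction of `BBS2015_cesaro_corrected_iff`, for users holding `(h : BBS2015_cesaro_corrected)`).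
[cite: BauerschmidtBrydgesSlade2015LogCorr, §1.3 and Theorem 1.1 (1.9)] -/
theorem BBS2015_cesaro_corrected.susceptibility_asymptotics (h : BBS2015_cesaro_corrected) :
    ∃ g₀ : ℝ, 0 < g₀ ∧ ∀ g : ℝ, 0 < g → g < g₀ →
      ∃ A : ℝ, 0 < A ∧
        Tendsto (fun ε : ℝ =>
            (susceptibility 4 g (criticalNu 4 g + ε)).toReal /
              (A * ε⁻¹ * Real.log ε⁻¹ ^ (1 / 4 : ℝ)))
          (𝓝[>] 0) (𝓝 1) :=
  BBS2015_cesaro_corrected_iff.1 h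

end CTWSAW

end Literature.Barriers.CriticalPhenomena
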